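import Summits.QuantumFields.YangMills.Theorems.BalabanUVNodesN15KingModelPerturbedNE2

/-!
# Route «BalabanUVNodes» (K4 «SpineRates»), node N15 = NE2 — THE KING-MODEL RUNG, part 6c: THE CONTINUUM LIMIT WITH THE BACKGROUND BLOCK LIVE —
# `C_E^{(k)} → C_E^{(∞)} = (D_E^{(∞)} + aL⁻²Q*Q)⁻¹` at every regular background, the uniform decay-keeping tail, the printed n-uniform shape of (4.38)
# for the dressed tower, the `LocalRate` currency, and `E ↦ C_E^{(∞)}` LIPSCHITZ in position space (NE2-LIP at `n = ∞`)

Cell `pub-ymgap`, Track A (D-0062), seat `pub-ymgap-dag-n15-d` (R134 seat, strategy s3 «King 1986 Lemma 4.5 (4.38) as the scalar kernel», gen 4;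
dag-lead FAN-OUT v1.2 §N15 s3 «KING-MODEL RUNG»).  `bears_on: R4∕N15`; `--supports` the K3′ item `SpineGivenEndpointR12` (stmt-QuantumFields-19908,
rev 15).  COUNT-NEUTRAL; definition lane (one `def`: the dressed limit kernel `kingCovLimE`, entrywise `limUnder`; every theorem is by-name plumbing of
part 5 `…KingModelContinuum` (`continuumLimit_of_leaves`, `towerInv_tendsto_kingCovLim`), part 6a `…KingModelPerturbedLeaves` and part 6b
`…KingModelPerturbedNE2` (`kingLeavesE`, `covarianceTowerRate_kingTowerE`, `kingCovE_lipschitz`, the thresholds)).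

CONTENTS (0 sorry).
§1 **`king_continuumLimit_E`** — part 5's socket-generic `continuumLimit_of_leaves` FIRED on the dressed leaves: at every background `E` local at rate
`κ′` with size `c_E ≤ c̄` and one-step rate `ε_E(L⁻²)^j`, the dressed tower converges entrywise (`Δ^{(j)} + E_j → D_E^{(∞)}`, tail
`(θ̄a + ε_E)(L⁻²)^j∕(1 − L⁻²)`), `D_E^{(∞)} + aL⁻²Q*Q` is coercive (`γ₀ − c_E V`), `C_E^{(∞)} = (D_E^{(∞)} + aL⁻²Q*Q)⁻¹` IDENTIFIED, `C_E^{(k)}(x, y) →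
C_E^{(∞)}(x, y)`, the limit decays at rate `κ′`, and (4.38) AT `n = ∞` with decay (the explicit `c_E`-dependent constants of the socket).
§2 THE DRESSED LIMIT AS AN OBJECT: `kingCovLimE E` (`C_E^{(∞)}`, entrywise `limUnder`); **`kingCovE_tendsto_kingCovLimE`** (identification
`C_E^{(∞)} = (D_E^{(∞)} + aL⁻²Q*Q)⁻¹`, `(D_E^{(∞)} + aL⁻²Q*Q)·C_E^{(∞)} = 1`, coercivity, convergence, and the UNIFORM decay-keeping tail
`|C_E^{(k)}(x,y) − C_E^{(∞)}(x,y)| ≤ C_K^E·e^{−δ₄₅|x−y|_T}·L^{−k}∕(1 − L⁻¹)` with part 6b's background-uniform constant `C_K^E`); `kingCovLimE_zero` (at the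
trivial background it IS part 5's `C^{(∞)} = kingCovLim`); **`kingCovLimE_lipschitz`** — `|C_0^{(∞)}(x, y) − C_E^{(∞)}(x, y)| ≤ c_E·Λ_K·e^{−δ₄₅|x−y|_T}`: THE
CONTINUUM-LIMIT COVARIANCE IS LIPSCHITZ IN THE BACKGROUND, LINEARLY IN ITS SIZE, WITH DECAY (6b's level-uniform `kingCovE_lipschitz` passed to the
limit; the position-space form at `n = ∞` of the Spine's operator-norm `NE2BackgroundLayer.pertLim_sub_pertLim_zero_le`); **`kingCovE_multiStep_rate`** —
the printed n-UNIFORM shape `|C_E^{(k+n)}(x,y) − C_E^{(k)}(x,y)| ≤ C_K^E·e^{−δ₄₅|x−y|_T}·L^{−k}∕(1 − L⁻¹)` for every `k, n`; **`localRate_kingTowerE`** — the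
dressed tower in the cell's `T4EtaRateMin.LocalRate` currency (part 4's `localRate_kingTower` with the background live).

HONEST FRAMING ∕ LIMITS.  As parts 6a∕6b: King's `A = 0` SCALAR tower on one finite torus (periodic b.c., `m² > 0`, `L ≥ 2`, levels `k ≥ 1`) dressed by
an ABSTRACT local perturbation tower whose two letters occupy the (3.35)∕(3.36) slots — for Bałaban's `Δ^{(k)}(U) − Δ^{(k)}(1)` NOT PRINTED (the
Spine's (H-bd)∕(H-cons) in position space), asserted by nobody; «continuum limit» = the lattice spacing `L^{−k} → 0` at FIXED unit-lattice volume;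
NOT Bałaban's `C^{(k)}(Λ; U)`; NOT the carriers of record; NOT a node discharge; typed 28∕28, discharged count untouched; nothing about ℝ⁴ ∕ infinite
volume ∕ OS ∕ mass gap ∕ Clay.  Locators only: [King1986] CMP **102** (1986) Lemma 4.5 (4.38) p. 674, (4.39)–(4.41) p. 675, §4 pp. 675–676; [B9] =
[Balaban1985BackgroundPropagators] CMP **99** (1985) (3.35)–(3.36) p. 396, Thm 3.15 (3.187) p. 432 (quantifier template).
-/

noncomputable section

open scoped BigOperators Matrix
open Finset Filter Topology

namespace Summit.QuantumFields.YangMills.BalabanUVNodes.N15.KingModel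

open Literature.MathematicalPhysics.QuantumFieldTheory.Balaban1983to89
open Literature.MathematicalPhysics.QuantumFieldTheory.Balaban1983to89.QGQInverse (Coercive)
open Literature.MathematicalPhysics.QuantumFieldTheory.Balaban1983to89.B5Prop11Plancherel (Tor fine)
open Literature.MathematicalPhysics.QuantumFieldTheory.Balaban1983to89.T4EtaRateMin (LocalRate abs_sub_le_of_geomRate)
open Literature.MathematicalPhysics.QuantumFieldTheory.King1986.Torus (tdistT tdistT_isPseudoDist aminL aminL_pos CDelU CDelU_pos gam0L gam0L_pos
  kapCT kapCT_pos_le V45 thetaBar delta45 delta45_pos)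
open Summit.QuantumFields.BalabanUV.T4Continuum.NE2KingTransplant (IsPseudoMetric UniformCoercive UniformCTBound UniformKernelDecay
  EffectiveOperatorSupRate VolumeSum CovarianceTowerRate covTowerReadings localRate_of_covarianceTowerRate covariance_entry_limit)

/-! ## §1 The continuum limit with the background live: `C_E^{(k)} → C_E^{(∞)}` at every regular background (part 5's `continuumLimit_of_leaves`) -/

section Limit

variable {dd : ℕ} {a m2 : ℝ} {L : ℕ} [NeZero L] {M : Fin dd → ℕ} [∀ μ, NeZero (M μ)]

/-- **THE CONTINUUM-LIMIT EFFECTIVE THEORY WITH THE BACKGROUND LIVE.**  At every background `E` local at rate `κ′` with size `c_E ≤ c̄` and with one-step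
rate `ε_E·(L⁻²)^j`: the dressed tower converges entrywise, `Δ^{(j)} + E_j → D_E^{(∞)}` (tail `(θ̄a + ε_E)(L⁻²)^j∕(1 − L⁻²)`); the limit is coercive,
`D_E^{(∞)} + aL⁻²Q*Q ≥ γ₀ − c_E V`; `C_E^{(∞)} = (D_E^{(∞)} + aL⁻²Q*Q)⁻¹` IDENTIFIED; `C_E^{(k)}(x, y) → C_E^{(∞)}(x, y)`; `C_E^{(∞)}` decays at rate `κ′`;
and (4.38) AT `n = ∞` with decay: `|C_E^{(k)}(x, y) − C_E^{(∞)}(x, y)| ≤ C·e^{−δ₄₅|x−y|_T}·L^{−k}∕(1 − L⁻¹)`.  Part 5's socket-generic `continuumLimit_of_leaves`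
on the dressed leaves — what the checklist buys a curved tower, exercised on one. [cite: King1986, Lemma 4.5 (4.38) p.674, §4 pp.675–676 (A = 0 template)] -/
theorem king_continuumLimit_E (ha : 0 < a) (hm : 0 < m2) (hL : 2 ≤ L) {E : ℕ → Matrix (Tor (fine L M)) (Tor (fine L M)) ℝ} {cE εE : ℝ}
    (hcE0 : 0 ≤ cE) (hcE : cE ≤ kingCbar dd a L) (hεE0 : 0 ≤ εE)
    (h335 : UniformKernelDecay E (tdistT (fine L M)) cE (kapCT dd a L)) (h336 : EffectiveOperatorSupRate E εE (((L : ℝ) ^ 2)⁻¹)) :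
    ∃ DinfE CinfE : Matrix (Tor (fine L M)) (Tor (fine L M)) ℝ,
      (∀ z w, Tendsto (fun k => (kingTower a m2 L M k + E k) z w) atTop (𝓝 (DinfE z w))) ∧
      (∀ k z w, |(kingTower a m2 L M k + E k) z w - DinfE z w|
        ≤ (thetaBar a L * a + εE) * (((L : ℝ) ^ 2)⁻¹) ^ k / (1 - ((L : ℝ) ^ 2)⁻¹)) ∧
      Coercive (DinfE + kingBlock a L M) (gam0L dd a L - cE * V45 dd a L) ∧ (DinfE + kingBlock a L M) * CinfE = 1 ∧
      CinfE = (DinfE + kingBlock a L M)⁻¹ ∧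
      (∀ x y, Tendsto (fun k => kingCovE a m2 L M E k x y) atTop (𝓝 (CinfE x y))) ∧
      (∀ x y, |CinfE x y| ≤ ((gam0L dd a L - cE * V45 dd a L) - ((kingRho dd a L + cE * V45 dd a L) + kingRhoB dd a L))⁻¹
        * Real.exp (-(kapCT dd a L * tdistT (fine L M) x y))) ∧
      (∀ k x y, |kingCovE a m2 L M E k x y - CinfE x y|
        ≤ Real.sqrt ((thetaBar a L * a + εE) * (2 * (CDelU dd a (aminL a L) + cE)))
            * (((gam0L dd a L - cE * V45 dd a L) - ((kingRho dd a L + cE * V45 dd a L) + kingRhoB dd a L))⁻¹) ^ 2 * V45 dd a L ^ 2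
            * Real.exp (-(delta45 dd a L * tdistT (fine L M) x y)) * ((L : ℝ)⁻¹) ^ k / (1 - (L : ℝ)⁻¹)) := by
  have hLr : (1 : ℝ) < L := by exact_mod_cast hL
  have hθ := thetaBar_mul_nonneg (a := a) ha hL
  have hr1 : ((L : ℝ) ^ 2)⁻¹ < 1 := inv_lt_one_of_one_lt₀ (by nlinarith)
  obtain ⟨g1, g2, g2', g3, g4⟩ := kingLeavesE (dd := dd) ha hm hL hcE0 h335 h336
  have hγ' : 0 < gam0L dd a L - cE * V45 dd a L := by
    have := kingMargin (dd := dd) ha hL hcE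
    have := gam0L_pos (d := dd) ha hL
    have h0 : 0 ≤ kingRho dd a L + cE * V45 dd a L + kingRhoB dd a L := by
      have hρ := (uniformCTBound_kingTower (M := M) ha hm hL)
      obtain ⟨hr, -, hrB, -⟩ := hρ
      have hV0 : 0 ≤ cE * V45 dd a L := mul_nonneg hcE0 (V45_pos dd ha hL).le
      have hpd := tdistT_isPseudoDist (fine L M)
      have hκ0 := (kapCT_pos_le (d := dd) ha hL).1.le
      have hρ0 : 0 ≤ kingRho dd a L := (Finset.sum_nonneg fun j _ => mul_nonneg (abs_nonneg _) (by
        have := Real.one_le_exp (mul_nonneg hκ0 (hpd.nonneg (0 : Tor (fine L M)) j)); linarith)).trans (hr 0 0)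
      have hρB0 : 0 ≤ kingRhoB dd a L := (Finset.sum_nonneg fun j _ => mul_nonneg (abs_nonneg _) (by
        have := Real.one_le_exp (mul_nonneg hκ0 (hpd.nonneg (0 : Tor (fine L M)) j)); linarith)).trans (hrB 0)
      linarith
    linarith
  obtain ⟨Dinf, Cinf, hD, hDt, hco, hmul, hCeq, hCt, hCdec, hrate⟩ :=
    continuumLimit_of_leaves (kingTower a m2 L M + E) (kingBlock a L M) (tdistT (fine L M)) (isPseudoMetric_tdistT (fine L M))
      (by have := kingGap (dd := dd) ha hL hcE; linarith) hγ' (kapCT_pos_le (d := dd) ha hL).1.le (add_nonneg hθ hεE0) (by positivity) hr1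
      g1 g2 g2' g3 g4
  have hsq : Real.sqrt (((L : ℝ) ^ 2)⁻¹) = (L : ℝ)⁻¹ := by rw [Real.sqrt_inv, Real.sqrt_sq (by positivity)]
  refine ⟨Dinf, Cinf, fun z w => hD z w, fun k z w => hDt k z w, hco, hmul, hCeq, fun x y => hCt x y, hCdec, fun k x y => ?_⟩
  have h := hrate k x y
  rw [hsq] at h; exact h

end Limit

/-! ## §2 The dressed limit as an object: identification, uniform tail, Lipschitz dependence on the background, `LocalRate` -/

section DressedLimit

variable {dd : ℕ} {a m2 : ℝ} {L : ℕ} [NeZero L] {M : Fin dd → ℕ} [∀ μ, NeZero (M μ)]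

/-- **THE CONTINUUM-LIMIT DRESSED COVARIANCE `C_E^{(∞)}` AS AN OBJECT**: the entrywise limit of the dressed covariances (`limUnder`; identified below
with `(D_E^{(∞)} + aL⁻²Q*Q)⁻¹` at every regular background). [cite: King1986, Lemma 4.5 (4.38) p.674, §4 pp.675–676 (A = 0 template)] -/
def kingCovLimE (a m2 : ℝ) (L : ℕ) [NeZero L] (M : Fin dd → ℕ) [∀ μ, NeZero (M μ)] (E : ℕ → Matrix (Tor (fine L M)) (Tor (fine L M)) ℝ) :
    Matrix (Tor (fine L M)) (Tor (fine L M)) ℝ :=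
  Matrix.of fun x y => limUnder atTop fun k => kingCovE a m2 L M E k x y

/-- **THE DRESSED TOWER IN THE CELL'S `LocalRate` CURRENCY** (constant `C_K^E` uniform over the backgrounds of size `≤ c̄`).
[cite: King1986, Lemma 4.5 (4.38) p.674 (A = 0 template)] -/
theorem localRate_kingTowerE (ha : 0 < a) (hm : 0 < m2) (hL : 2 ≤ L) {E : ℕ → Matrix (Tor (fine L M)) (Tor (fine L M)) ℝ} {cE εE : ℝ}
    (hcE0 : 0 ≤ cE) (hcE : cE ≤ kingCbar dd a L) (hεE0 : 0 ≤ εE) (hεE : εE ≤ kingCbar dd a L)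
    (h335 : UniformKernelDecay E (tdistT (fine L M)) cE (kapCT dd a L)) (h336 : EffectiveOperatorSupRate E εE (((L : ℝ) ^ 2)⁻¹)) :
    LocalRate (covTowerReadings (kingTower a m2 L M + E) (kingBlock a L M)) (kingCE dd a L) ((L : ℝ)⁻¹) :=
  localRate_of_covarianceTowerRate (kingCE_pos (dd := dd) ha hL).2.le (inv_L_nonneg_lt_one hL).1 (delta45_pos (d := dd) ha hL).le
    (tdistT_isPseudoDist (fine L M)).nonneg (covarianceTowerRate_kingTowerE ha hm hL hcE0 hcE hεE0 hεE h335 h336)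

/-- **`C_E^{(k)}(x, y) → C_E^{(∞)}(x, y)` WITH THE UNIFORM DECAY-KEEPING TAIL** `C_K^E·e^{−δ₄₅|x−y|_T}·L^{−k}∕(1 − L⁻¹)` at every background of size `≤ c̄`,
and the identification `C_E^{(∞)} = (D_E^{(∞)} + aL⁻²Q*Q)⁻¹` with the limit `D_E^{(∞)}` of the dressed tower. [cite: King1986, Lemma 4.5 (4.38) p.674, §4 pp.675–676 (A = 0 template)] -/
theorem kingCovE_tendsto_kingCovLimE (ha : 0 < a) (hm : 0 < m2) (hL : 2 ≤ L) {E : ℕ → Matrix (Tor (fine L M)) (Tor (fine L M)) ℝ} {cE εE : ℝ}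
    (hcE0 : 0 ≤ cE) (hcE : cE ≤ kingCbar dd a L) (hεE0 : 0 ≤ εE) (hεE : εE ≤ kingCbar dd a L)
    (h335 : UniformKernelDecay E (tdistT (fine L M)) cE (kapCT dd a L)) (h336 : EffectiveOperatorSupRate E εE (((L : ℝ) ^ 2)⁻¹)) :
    ∃ DinfE : Matrix (Tor (fine L M)) (Tor (fine L M)) ℝ,
      (∀ z w, Tendsto (fun k => (kingTower a m2 L M k + E k) z w) atTop (𝓝 (DinfE z w))) ∧
      kingCovLimE a m2 L M E = (DinfE + kingBlock a L M)⁻¹ ∧ (DinfE + kingBlock a L M) * kingCovLimE a m2 L M E = 1 ∧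
      Coercive (DinfE + kingBlock a L M) (gam0L dd a L - cE * V45 dd a L) ∧
      (∀ x y, Tendsto (fun k => kingCovE a m2 L M E k x y) atTop (𝓝 (kingCovLimE a m2 L M E x y))) ∧
      (∀ k x y, |kingCovE a m2 L M E k x y - kingCovLimE a m2 L M E x y|
        ≤ kingCE dd a L * Real.exp (-(delta45 dd a L * tdistT (fine L M) x y)) * ((L : ℝ)⁻¹) ^ k / (1 - (L : ℝ)⁻¹)) := by
  obtain ⟨Dinf, Cinf, hD, -, hco, hmul, hCeq, hCt, -, -⟩ := king_continuumLimit_E (dd := dd) ha hm hL hcE0 hcE hεE0 h335 h336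
  have hlim : kingCovLimE a m2 L M E = Cinf := by
    ext x y
    simp only [kingCovLimE, Matrix.of_apply]
    exact (hCt x y).limUnder_eq
  refine ⟨Dinf, hD, hlim.trans hCeq, by rw [hlim]; exact hmul, hco, fun x y => by rw [hlim]; exact hCt x y, fun k x y => ?_⟩
  -- the uniform tail: telescope the dressed one-step rate from level k on and pass to the limit
  have hrate := covarianceTowerRate_kingTowerE (dd := dd) ha hm hL hcE0 hcE hεE0 hεE h335 h336
  have hLi := inv_L_nonneg_lt_one hL
  have hstep : ∀ j, |kingCovE a m2 L M E (j + 1) x y - kingCovE a m2 L M E j x y|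
      ≤ kingCE dd a L * Real.exp (-(delta45 dd a L * tdistT (fine L M) x y)) * ((L : ℝ)⁻¹) ^ j := by
    intro j
    have h := hrate j x y
    rw [abs_sub_comm] at h
    calc |kingCovE a m2 L M E (j + 1) x y - kingCovE a m2 L M E j x y|
        ≤ kingCE dd a L * ((L : ℝ)⁻¹) ^ j * Real.exp (-(delta45 dd a L * tdistT (fine L M) x y)) := h
      _ = kingCE dd a L * Real.exp (-(delta45 dd a L * tdistT (fine L M) x y)) * ((L : ℝ)⁻¹) ^ j := by ring
  have hgeo := abs_sub_le_of_geomRate (u := fun j => kingCovE a m2 L M E j x y) hLi.1 hLi.2 hstep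
  -- pass n → ∞ in |u (k+n) − u k| ≤ tail
  have ht : Tendsto (fun n => kingCovE a m2 L M E (k + n) x y) atTop (𝓝 (kingCovLimE a m2 L M E x y)) := by
    rw [hlim]; exact (hCt x y).comp (tendsto_atTop_atTop_of_monotone (fun _ _ h => by omega) fun b => ⟨b, by omega⟩)
  have hconst : Tendsto (fun _ : ℕ => kingCovE a m2 L M E k x y) atTop (𝓝 (kingCovE a m2 L M E k x y)) := tendsto_const_nhds
  have hdiff := (hconst.sub ht).abs
  refine le_of_tendsto hdiff (Filter.Eventually.of_forall fun n => ?_)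
  have h := hgeo k n
  rw [abs_sub_comm] at h
  exact h

/-- At the trivial background the dressed limit IS part 5's `C^{(∞)} = kingCovLim` (both are entrywise limits of the same sequence from level 1 on).
[folklore] -/
theorem kingCovLimE_zero {d : ℕ} {L : ℕ} [NeZero L] {a m2 : ℝ} (ha : 0 < a) (hm : 0 < m2) (hL : 2 ≤ L) (M : Fin (d + 1) → ℕ) [∀ μ, NeZero (M μ)] :
    kingCovLimE a m2 L M 0 = kingCovLim a m2 L M := by
  ext x y
  have h1 : Tendsto (fun k => kingCovE a m2 L M 0 k x y) atTop (𝓝 (kingCovLim a m2 L M x y)) := by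
    refine (towerInv_tendsto_kingCovLim (M := M) ha hm hL x y).congr' (Filter.Eventually.of_forall fun k => ?_)
    show _ = kingCovE a m2 L M 0 k x y
    rw [kingCovE_zero]
  simp only [kingCovLimE, Matrix.of_apply]
  exact h1.limUnder_eq

/-- **THE CONTINUUM-LIMIT COVARIANCE IS LIPSCHITZ IN THE BACKGROUND, WITH DECAY** (NE2-LIP at `n = ∞` in position space): for a background local at
rate `κ′` with size `c_E ≤ c̄` and any one-step rate `≤ c̄`, `|C_0^{(∞)}(x, y) − C_E^{(∞)}(x, y)| ≤ c_E·Λ_K·e^{−δ₄₅|x−y|_T}` (the level-uniform bound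
`kingCovE_lipschitz` passed to the limit). [cite: King1986, (4.39)–(4.41) p.675 (the mechanism, A = 0)] -/
theorem kingCovLimE_lipschitz (ha : 0 < a) (hm : 0 < m2) (hL : 2 ≤ L) {E : ℕ → Matrix (Tor (fine L M)) (Tor (fine L M)) ℝ} {cE εE : ℝ}
    (hcE0 : 0 ≤ cE) (hcE : cE ≤ kingCbar dd a L) (hεE0 : 0 ≤ εE) (hεE : εE ≤ kingCbar dd a L)
    (h335 : UniformKernelDecay E (tdistT (fine L M)) cE (kapCT dd a L)) (h336 : EffectiveOperatorSupRate E εE (((L : ℝ) ^ 2)⁻¹))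
    (x y : Tor (fine L M)) :
    |kingCovLimE a m2 L M 0 x y - kingCovLimE a m2 L M E x y| ≤ cE * kingLip dd a L * Real.exp (-(delta45 dd a L * tdistT (fine L M) x y)) := by
  have hcb := (kingCbar_pos (dd := dd) ha hL).le
  have h0 : UniformKernelDecay (0 : ℕ → Matrix (Tor (fine L M)) (Tor (fine L M)) ℝ) (tdistT (fine L M)) 0 (kapCT dd a L) := by
    intro k z w; simp
  have h0' : EffectiveOperatorSupRate (0 : ℕ → Matrix (Tor (fine L M)) (Tor (fine L M)) ℝ) 0 (((L : ℝ) ^ 2)⁻¹) := by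
    intro k z w; simp
  obtain ⟨-, -, -, -, -, htE, -⟩ := kingCovE_tendsto_kingCovLimE (dd := dd) ha hm hL hcE0 hcE hεE0 hεE h335 h336
  obtain ⟨-, -, -, -, -, ht0, -⟩ := kingCovE_tendsto_kingCovLimE (dd := dd) ha hm hL le_rfl hcb le_rfl hcb h0 h0'
  refine le_of_tendsto ((ht0 x y).sub (htE x y)).abs (Filter.Eventually.of_forall fun k => ?_)
  have h := kingCovE_lipschitz (dd := dd) ha hm hL hcE0 hcE h335 k x y
  rwa [kingCovE_zero] 

/-- **THE PRINTED n-UNIFORM SHAPE OF (4.38) FOR THE DRESSED TOWER**: `|C_E^{(k+n)}(x, y) − C_E^{(k)}(x, y)| ≤ C_K^E·e^{−δ₄₅|x−y|_T}·L^{−k}∕(1 − L⁻¹)` for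
every `k, n`, uniformly over the backgrounds of size `≤ c̄` (the one-step dressed rate telescoped, decay kept). [cite: King1986, Lemma 4.5 (4.38) p.674 (A = 0 template)] -/
theorem kingCovE_multiStep_rate (ha : 0 < a) (hm : 0 < m2) (hL : 2 ≤ L) {E : ℕ → Matrix (Tor (fine L M)) (Tor (fine L M)) ℝ} {cE εE : ℝ}
    (hcE0 : 0 ≤ cE) (hcE : cE ≤ kingCbar dd a L) (hεE0 : 0 ≤ εE) (hεE : εE ≤ kingCbar dd a L)
    (h335 : UniformKernelDecay E (tdistT (fine L M)) cE (kapCT dd a L)) (h336 : EffectiveOperatorSupRate E εE (((L : ℝ) ^ 2)⁻¹))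
    (k n : ℕ) (x y : Tor (fine L M)) :
    |kingCovE a m2 L M E (k + n) x y - kingCovE a m2 L M E k x y|
      ≤ kingCE dd a L * Real.exp (-(delta45 dd a L * tdistT (fine L M) x y)) * ((L : ℝ)⁻¹) ^ k / (1 - (L : ℝ)⁻¹) := by
  have hrate := covarianceTowerRate_kingTowerE (dd := dd) ha hm hL hcE0 hcE hεE0 hεE h335 h336
  have hLi := inv_L_nonneg_lt_one hL
  refine abs_sub_le_of_geomRate (u := fun j => kingCovE a m2 L M E j x y) hLi.1 hLi.2 (fun j => ?_) k n
  have h := hrate j x y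
  rw [abs_sub_comm] at h
  calc |kingCovE a m2 L M E (j + 1) x y - kingCovE a m2 L M E j x y|
      ≤ kingCE dd a L * ((L : ℝ)⁻¹) ^ j * Real.exp (-(delta45 dd a L * tdistT (fine L M) x y)) := h
    _ = kingCE dd a L * Real.exp (-(delta45 dd a L * tdistT (fine L M) x y)) * ((L : ℝ)⁻¹) ^ j := by ring

end DressedLimit

end Summit.QuantumFields.YangMills.BalabanUVNodes.N15.KingModel

end
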